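import Literature.MathematicalPhysics.QuantumFieldTheory.Balaban1983to89.Node00.CriticalOnFibreTangent
import Literature.MathematicalPhysics.QuantumFieldTheory.Balaban1983to89.Beta.TransportVertices
import Literature.MathematicalPhysics.QuantumFieldTheory.Balaban1983to89.MatrixNorms

/-!
# NODE 00 — THE SECOND VARIATION OF THE WILSON ACTION (5) AT A BACKGROUND, IN THE EXPONENTIAL CHART OF RECORD:
# `d²∕dt² A(U·e^{tX})∣₀ = −(1∕N)·Σ_p Re Tr( [(Σ_k X′_k)² + Σ_{k<l}[X′_k, X′_l]]·U(∂p) )` — [B9] (3.1)–(3.2), (3.6)–(3.7) with `U(∂p)` EXACT,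
# the object `Δ₁ = Δ(ζ₀ ≡ 1)` of [B16] (1.12) ∕ (1.17), typed in the N07∕N12 `Setup` currency (`SU(N)`, `wilsonAction4`, `Node00.expChart`)

Cell `pub-ymgap`, WIDTH SEAT `pub-ymgap-dag-n12-w2` generation 0 (HUMAN RULING D-0149 ∕ director-ym №197; DAG node N12 = [B15]; W-SEAT-START-LIST v2 §N12
ITEM 2 = U2a «the SECOND VARIATION of `wilsonAction4` at a background (Δ₁(ζ₀); N06∕N07 currency — n07-e 35f is the first variation)»; INBOX CLAIM l.24166).
NEW leaf; CONSUMED BY NAME: n07-e's `Node00.WilsonActionFirstVariation` (`coe_plaqHol_eq`, `hasDerivAt_wilsonAction4`) and `Node00.CriticalOnFibreTangent`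
(`expChart U X = (b ↦ U_b·exp X_b)`), the tree's `T4AdjointCovarianceUnitary` (`lieSU`, `expSU`, `exp_conj_unitary`), pub-balaban's per-contour engine
`Beta.TransportVertices` (`holPath`, `D₁`, `D₂`, `quad`, `commSum`, `size`, `hasDerivAt_holPath`, `hasDerivAt_D₁`, `D₂_zero`, `norm_holonomy_sub_taylor_two_le'`)
and `MatrixNorms.abs_nReTr_le_opNorm` (B7 (20)).  `--kind proof --supports stmt-QuantumFields-20542 --as helper` (K1⁷; count-neutral).

PRINT.  T. Bałaban, *Propagators for lattice gauge theories in a background field*, Commun. Math. Phys. **99** (1985) 389–434 [Balaban1985BackgroundPropagators]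
= [B9], p. 390 (3.1): «A^η(U′U₀) = Σ_p η^{d−4}[1 − Re tr(U′U₀)(∂p)], tr(U′U₀)(∂p) = tr(∂₀U′)((p)_z)U₀(∂p) … R(U)X = UXU⁻¹», «U′ = exp iηA»; (3.2): «(∂₀U′)((p)_z) =
1 + iη Σ_{b⊂∂(p)_z} A′(b) − ½η²[Σ_b (A′(b))² + 2 Σ_{b₁≺b₂} A′(b₁)A′(b₂)] + ⋯», the transported letters «A′(z,w) = R(U₀(x,w))A(z,w), A′(w,x) = A(w,x), …»;
p. 391 (3.5) «A(x,x′) = −A(x′,x)», (3.6)–(3.7): «A^η(U′U₀) = A^η(U₀) + ⟨D^η_{U₀}A, η⁻²Im ∂U₀⟩ + ½⟨A, Δ^η(U₀)A⟩ + ⋯», the bracket of the quadratic term being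
«tr((D^η_{U₀}A)(p))² Re U₀(∂p) + tr Σ_{b₁≺b₂} i[A′(b₁),A′(b₂)] η⁻²Im U₀(∂p)», i.e. `(Σ_k a_k)²` and the ORDERED COMMUTATOR SUM `Σ_{k<l}[a_k,a_l]` of the letters
`a_k = iηA′(b_k)` against the EXACT plaquette variable; p. 392: «The quadratic terms in the expansion (3.7) define the basic operator … Δ^η(U), or simply Δ.»
T. Bałaban, *Large field renormalization. II*, Commun. Math. Phys. **122** (1989) 355–392 [Balaban1989LargeFieldII] = [B16], p. 359 (1.12): «⟨δB′, H_{1,k}Δ₁H_{1,k}B′⟩»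
(ζ₀ = 1), p. 360 (1.17): «A(ζ₀, exp(iηH′)U) = A(ζ₀,U) + … + ½⟨H′, Δ(ζ₀)H′⟩ + V₀(ζ₀, H′)», p. 357: «the function V is at least of third order».

READING (declared).  Print perturbs on the LEFT (`U′U₀`) and transports to the corner `z`; the tree's chart of record `Node00.expChart` perturbs on the RIGHT
(`U_b ↦ U_b·e^{tX_b}`, `X_b ∈ 𝔰𝔲(N)` skew-Hermitian, n07-e 35a), so the letters are transported to the corner `x = p.src` along `∂p = ⟨x,μ⟩⟨x+e_μ,ν⟩⟨x+e_ν,μ⟩⁻¹⟨x,ν⟩⁻¹`: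
with `𝕌₁ = U⟨x,μ⟩, 𝕌₂ = U⟨x+e_μ,ν⟩, 𝕌₃ = U⟨x+e_ν,μ⟩, 𝕌₄ = U⟨x,ν⟩`, `U(∂p) = 𝕌₁𝕌₂𝕌₃⋆𝕌₄⋆` (`coe_plaqHol_eq`), the four letters in contour order are
`X′₁ = 𝕌₁𝕏₁𝕌₁⋆`, `X′₂ = (𝕌₁𝕌₂)𝕏₂(𝕌₁𝕌₂)⋆`, `X′₃ = −(𝕌₁𝕌₂)𝕏₃(𝕌₁𝕌₂)⋆`, `X′₄ = −(𝕌₁𝕌₂𝕌₃⋆)𝕏₄(𝕌₁𝕌₂𝕌₃⋆)⋆` (the two backward bonds with the sign of (3.5)), and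
`(U·e^{tX})(∂p) = e^{tX′₁}e^{tX′₂}e^{tX′₃}e^{tX′₄}·U(∂p)` — (3.1) with `(∂₀U′)` on the left of the exact `U(∂p)`.  `Σ_k X′_k = η·(D^η_U X)(p)` is (3.4) read at `x`;
nothing about `D^η` is asserted here.  The normalised trace `Re tr = Re Tr∕N` is `Setup.reTr` at `SU(N)` (`reTr_eq_traceLinearMap`, rfl).

CONTENTS (theorems only; no `def`, no `instance`).
* §0 bookkeeping at `SU(N)` ∕ `𝔰𝔲(N)`: cancellations `g⋆(gM) = M`, `g(g⋆M) = M`, `↑(g⁻¹) = (↑g)⋆`, `X⋆ = −X`, `exp(t·gYg⋆) = g·e^{tY}·g⋆` (± sign), `(e^{tX})⋆ = e^{−tX}`.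
* §1 `coe_expChart_smul`, `hasDerivAt_coe_expChart_smul` — the ray `t ↦ U_b·exp(tX_b)` and its velocity `U_b·e^{tX_b}·X_b` at EVERY `t`.
* §2 ★ `mul_mul_star_mul_star_expSU_eq_holPath_mul` (four unitaries, four letters) and ★ `coe_plaqHol_expChart_smul` — the factorisation (3.1) with the letters (3.2)∕(3.5).
* §3–§4 `wilsonAction4_expChart_smul_eq` — `A(U·e^{tX}) = Σ_p (1 − Re Tr(holPath ℝ [X′₁,X′₂,X′₃,X′₄] t · U(∂p))∕N)`; `hasDerivAt_wilsonAction4_expChart_smul` (every `t`,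
  derivative through `D₁`), `hasDerivAt_firstVariation_expChart_smul` (every `t`, through `D₂`: the action along the ray is `C²`), ★★★ `hasDerivAt_deriv_wilsonAction4_expChart`
  — THE SECOND VARIATION AT `t = 0` in the letters of (3.6)–(3.7), ★ `deriv_wilsonAction4_expChart_zero` (the first variation at `0`, the linear term of (3.7)).
* SEQUEL (`Node00.WilsonActionSecondVariationExpansion`, same seat): the (3.2) shape (four squares + twice six ordered pairs INSERTED into `𝕌₁𝕌₂𝕌₃⋆𝕌₄⋆`; the first
  variation = g8's four-term Leibniz sum), the cubic remainder of (3.7)'s «+ ⋯» ([B16] p.357 «V is at least of third order»), and the form at `U(∂p) = 1` («the quadratic form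
  with the background field identically equal to 1», [B16] p.357; «∂*∂ in the Abelian case», [B9] p.392).

HONEST FRAMING: a calculus ∕ algebra identity about the tree's own action functional (finite sums, the matrix exponential, trace cyclicity, unitarity); nothing of
Bałaban's ESTIMATES is asserted; dischargeability-neutral for N12's (L2) letter `hlead` until the linearised minimiser (U2b) and the comparison with [10] (1.65)–(1.67)
(U2c) exist; count-neutral; N12 NOT discharged (5∕27 unmoved); one finite 𝕋⁴ programme at fixed ε, Bałaban AS PRINTED with locators; R4 closes the conditional rung
`BalabanLadder.UV` only — NOT continuum ∕ ℝ⁴ ∕ OS ∕ mass gap ∕ Clay.  No `sorry`, no `def`, no `instance`.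
-/

noncomputable section

namespace Literature.MathematicalPhysics.QuantumFieldTheory.Balaban1983to89.Node00

open Filter Topology
open T4AdjointCovarianceUnitary (lieSU expSU coe_expSU mem_lieSU_iff toUnitary coe_toUnitary exp_conj_unitary)
open Beta.TransportVertices (holPath holonomy D₁ D₂ quad commSum size holPath_cons holPath_nil hasDerivAt_holPath hasDerivAt_D₁ D₁_zero D₂_zero
  norm_holonomy_sub_taylor_two_le')
open scoped Matrix.Norms.L2Operator

/-! ## §0  Matrix bookkeeping for `SU(N)` and `𝔰𝔲(N)` -/

section Bookkeeping

variable {N : ℕ}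

/-- `g⋆·g = 1` for `g ∈ SU(N)`. [cite: Balaban1985Variational, (4) p.278 (the group; bookkeeping)] -/
theorem star_coe_mul_coe_SU (g : SU N) : star (g : Matrix (Fin N) (Fin N) ℂ) * (g : Matrix (Fin N) (Fin N) ℂ) = 1 :=
  Unitary.star_mul_self_of_mem (Matrix.specialUnitaryGroup_le_unitaryGroup g.2)

/-- `g·g⋆ = 1` for `g ∈ SU(N)`. [cite: Balaban1985Variational, (4) p.278 (the group; bookkeeping)] -/
theorem coe_mul_star_coe_SU (g : SU N) : (g : Matrix (Fin N) (Fin N) ℂ) * star (g : Matrix (Fin N) (Fin N) ℂ) = 1 :=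
  Unitary.mul_star_self_of_mem (Matrix.specialUnitaryGroup_le_unitaryGroup g.2)

/-- Left cancellation `g⋆·(g·M) = M`. [cite: Balaban1985Variational, (4) p.278 (the group; bookkeeping)] -/
theorem star_coe_mul_coe_mul_SU (g : SU N) (M : Matrix (Fin N) (Fin N) ℂ) : star (g : Matrix (Fin N) (Fin N) ℂ) * ((g : Matrix (Fin N) (Fin N) ℂ) * M) = M := by
  rw [← mul_assoc, star_coe_mul_coe_SU, one_mul]

/-- Left cancellation `g·(g⋆·M) = M`. [cite: Balaban1985Variational, (4) p.278 (the group; bookkeeping)] -/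
theorem coe_mul_star_coe_mul_SU (g : SU N) (M : Matrix (Fin N) (Fin N) ℂ) : (g : Matrix (Fin N) (Fin N) ℂ) * (star (g : Matrix (Fin N) (Fin N) ℂ) * M) = M := by
  rw [← mul_assoc, coe_mul_star_coe_SU, one_mul]

/-- `↑(g⁻¹) = (↑g)⋆` in `SU(N)` (definitional). [cite: Balaban1985BackgroundPropagators, (3.5) p.391 («U(x,x′) = U⁻¹(x′,x)»)] -/
theorem coe_inv_SU (g : SU N) : ((g⁻¹ : SU N) : Matrix (Fin N) (Fin N) ℂ) = star (g : Matrix (Fin N) (Fin N) ℂ) := rfl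

/-- A Lie-algebra letter is skew-Hermitian: `X⋆ = −X` for `X ∈ 𝔰𝔲(N)`. [cite: Balaban1985BackgroundPropagators, (3.2) p.390 («U′ = exp iηA», `A` hermitian)] -/
theorem star_coe_lieSU (X : lieSU (Fin N)) : star (X : Matrix (Fin N) (Fin N) ℂ) = -(X : Matrix (Fin N) (Fin N) ℂ) := (mem_lieSU_iff.mp X.2).1

/-- `exp(t·gYg⋆) = g·exp(tY)·g⋆` for `g ∈ SU(N)` («R(X)f(Y) = f(R(X)Y) for analytic functions f», the tree's `exp_conj_unitary`).
[cite: Balaban1985BackgroundPropagators, (3.1) p.390 («R(U)X = UXU⁻¹»)] -/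
theorem exp_smul_conj_SU (g : SU N) (t : ℝ) (Y : Matrix (Fin N) (Fin N) ℂ) :
    NormedSpace.exp (t • ((g : Matrix (Fin N) (Fin N) ℂ) * Y * star (g : Matrix (Fin N) (Fin N) ℂ))) = (g : Matrix (Fin N) (Fin N) ℂ) * NormedSpace.exp (t • Y) * star (g : Matrix (Fin N) (Fin N) ℂ) := by
  rw [← smul_mul_assoc, ← mul_smul_comm]
  exact exp_conj_unitary (toUnitary g) (t • Y)

/-- … and for a letter with the sign of a backward bond: `exp(t·(−gYg⋆)) = g·exp(−tY)·g⋆`. [cite: Balaban1985BackgroundPropagators, (3.5) p.391] -/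
theorem exp_smul_neg_conj_SU (g : SU N) (t : ℝ) (Y : Matrix (Fin N) (Fin N) ℂ) :
    NormedSpace.exp (t • -((g : Matrix (Fin N) (Fin N) ℂ) * Y * star (g : Matrix (Fin N) (Fin N) ℂ))) = (g : Matrix (Fin N) (Fin N) ℂ) * NormedSpace.exp (-(t • Y)) * star (g : Matrix (Fin N) (Fin N) ℂ) := by
  rw [smul_neg, ← smul_mul_assoc, ← mul_smul_comm, ← neg_mul, ← mul_neg]
  exact exp_conj_unitary (toUnitary g) (-(t • Y))

/-- The adjoint of a chart factor: `(exp(tX))⋆ = exp(−tX)` for skew-Hermitian `X`. [cite: Balaban1985BackgroundPropagators, (3.5) p.391 («U(x,x′) = U⁻¹(x′,x)»)] -/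
theorem star_exp_smul_lieSU (X : lieSU (Fin N)) (t : ℝ) :
    star (NormedSpace.exp (t • (X : Matrix (Fin N) (Fin N) ℂ))) = NormedSpace.exp (-(t • (X : Matrix (Fin N) (Fin N) ℂ))) := by
  rw [NormedSpace.star_exp, star_smul, star_trivial, star_coe_lieSU, smul_neg]

end Bookkeeping

/-! ## §1  The ray `t ↦ U·exp(tX)` of the exponential chart and its bond-wise velocity at every `t` -/

section Ray

variable {P : Params} {j : ℕ} {N : ℕ}

/-- The matrix of the ray at a bond: `↑((U·e^{tX})_b) = 𝕌_b·exp(t𝕏_b)`. [cite: Balaban1985BackgroundPropagators, (3.1) p.390 («U′ = exp iηA»)] -/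
theorem coe_expChart_smul (U : GaugeField P j (SU N)) (X : PBond P j → lieSU (Fin N)) (t : ℝ) (b : PBond P j) :
    ((expChart U (t • X) b : SU N) : Matrix (Fin N) (Fin N) ℂ) = (U b : Matrix (Fin N) (Fin N) ℂ) * NormedSpace.exp (t • (X b : Matrix (Fin N) (Fin N) ℂ)) := by
  rw [coe_expChart]
  rfl

/-- ★ **VELOCITY OF THE RAY AT EVERY `t`**: `d∕dt 𝕌_b·exp(t𝕏_b) = 𝕌_b·exp(t𝕏_b)·𝕏_b` (Mathlib `hasDerivAt_exp_smul_const`).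
[cite: Balaban1985BackgroundPropagators, (3.2) p.390 (first order of the exponential)] -/
theorem hasDerivAt_coe_expChart_smul (U : GaugeField P j (SU N)) (X : PBond P j → lieSU (Fin N)) (b : PBond P j) (t : ℝ) :
    HasDerivAt (fun s : ℝ => ((expChart U (s • X) b : SU N) : Matrix (Fin N) (Fin N) ℂ))
      ((U b : Matrix (Fin N) (Fin N) ℂ) * (NormedSpace.exp (t • (X b : Matrix (Fin N) (Fin N) ℂ)) * (X b : Matrix (Fin N) (Fin N) ℂ))) t := by
  have hfun : (fun s : ℝ => ((expChart U (s • X) b : SU N) : Matrix (Fin N) (Fin N) ℂ)) = fun s : ℝ => (U b : Matrix (Fin N) (Fin N) ℂ) * NormedSpace.exp (s • (X b : Matrix (Fin N) (Fin N) ℂ)) :=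
    funext fun s => coe_expChart_smul U X s b
  rw [hfun]
  exact (hasDerivAt_exp_smul_const (X b : Matrix (Fin N) (Fin N) ℂ) t).const_mul (U b : Matrix (Fin N) (Fin N) ℂ)

end Ray

/-! ## §2  The factorisation (3.1): `(U·e^{tX})(∂p) = e^{tX′₁}e^{tX′₂}e^{tX′₃}e^{tX′₄}·U(∂p)` with the transported letters (3.2)∕(3.5) -/

section Factorisation

variable {N : ℕ}

/-- ★ **FOUR UNITARIES, FOUR LETTERS**: for `A, B, C, D ∈ SU(N)` and `X₁, …, X₄ ∈ 𝔰𝔲(N)`,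
`(Ae^{tX₁})(Be^{tX₂})(Ce^{tX₃})⋆(De^{tX₄})⋆ = e^{tX′₁}e^{tX′₂}e^{tX′₃}e^{tX′₄}·(ABC⋆D⋆)` with `X′₁ = AX₁A⋆`, `X′₂ = (AB)X₂(AB)⋆`, `X′₃ = −(AB)X₃(AB)⋆`,
`X′₄ = −(ABC⋆)X₄(ABC⋆)⋆` — the letters transported to the start of the contour, the two backward edges with the sign of (3.5); `holPath ℝ [a₁,…,a₄] t = Π_k e^{t a_k}`
is pub-balaban's transport path. [cite: Balaban1985BackgroundPropagators, (3.1)–(3.2) p.390, (3.5) p.391] -/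
theorem mul_mul_star_mul_star_expSU_eq_holPath_mul (A B C D : SU N) (X₁ X₂ X₃ X₄ : lieSU (Fin N)) (t : ℝ) :
    (A : Matrix (Fin N) (Fin N) ℂ) * NormedSpace.exp (t • (X₁ : Matrix (Fin N) (Fin N) ℂ)) * ((B : Matrix (Fin N) (Fin N) ℂ) * NormedSpace.exp (t • (X₂ : Matrix (Fin N) (Fin N) ℂ)))
        * star ((C : Matrix (Fin N) (Fin N) ℂ) * NormedSpace.exp (t • (X₃ : Matrix (Fin N) (Fin N) ℂ))) * star ((D : Matrix (Fin N) (Fin N) ℂ) * NormedSpace.exp (t • (X₄ : Matrix (Fin N) (Fin N) ℂ)))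
      = holPath ℝ [ (A : Matrix (Fin N) (Fin N) ℂ) * (X₁ : Matrix (Fin N) (Fin N) ℂ) * star (A : Matrix (Fin N) (Fin N) ℂ),
            (A : Matrix (Fin N) (Fin N) ℂ) * (B : Matrix (Fin N) (Fin N) ℂ) * (X₂ : Matrix (Fin N) (Fin N) ℂ) * star ((A : Matrix (Fin N) (Fin N) ℂ) * (B : Matrix (Fin N) (Fin N) ℂ)),
            -((A : Matrix (Fin N) (Fin N) ℂ) * (B : Matrix (Fin N) (Fin N) ℂ) * (X₃ : Matrix (Fin N) (Fin N) ℂ) * star ((A : Matrix (Fin N) (Fin N) ℂ) * (B : Matrix (Fin N) (Fin N) ℂ))),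
            -((A : Matrix (Fin N) (Fin N) ℂ) * (B : Matrix (Fin N) (Fin N) ℂ) * star (C : Matrix (Fin N) (Fin N) ℂ) * (X₄ : Matrix (Fin N) (Fin N) ℂ) * star ((A : Matrix (Fin N) (Fin N) ℂ) * (B : Matrix (Fin N) (Fin N) ℂ) * star (C : Matrix (Fin N) (Fin N) ℂ))) ] t
          * ((A : Matrix (Fin N) (Fin N) ℂ) * (B : Matrix (Fin N) (Fin N) ℂ) * star (C : Matrix (Fin N) (Fin N) ℂ) * star (D : Matrix (Fin N) (Fin N) ℂ)) := by
  -- the three transporters as elements of `SU(N)`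
  have h2 : ((A * B : SU N) : Matrix (Fin N) (Fin N) ℂ) = (A : Matrix (Fin N) (Fin N) ℂ) * (B : Matrix (Fin N) (Fin N) ℂ) := rfl
  have h3 : ((A * B * C⁻¹ : SU N) : Matrix (Fin N) (Fin N) ℂ) = (A : Matrix (Fin N) (Fin N) ℂ) * (B : Matrix (Fin N) (Fin N) ℂ) * star (C : Matrix (Fin N) (Fin N) ℂ) := rfl
  have e1 : NormedSpace.exp (t • ((A : Matrix (Fin N) (Fin N) ℂ) * (X₁ : Matrix (Fin N) (Fin N) ℂ) * star (A : Matrix (Fin N) (Fin N) ℂ))) = (A : Matrix (Fin N) (Fin N) ℂ) * NormedSpace.exp (t • (X₁ : Matrix (Fin N) (Fin N) ℂ)) * star (A : Matrix (Fin N) (Fin N) ℂ) :=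
    exp_smul_conj_SU A t _
  have e2 : NormedSpace.exp (t • ((A : Matrix (Fin N) (Fin N) ℂ) * (B : Matrix (Fin N) (Fin N) ℂ) * (X₂ : Matrix (Fin N) (Fin N) ℂ) * star ((A : Matrix (Fin N) (Fin N) ℂ) * (B : Matrix (Fin N) (Fin N) ℂ))))
      = (A : Matrix (Fin N) (Fin N) ℂ) * (B : Matrix (Fin N) (Fin N) ℂ) * NormedSpace.exp (t • (X₂ : Matrix (Fin N) (Fin N) ℂ)) * star ((A : Matrix (Fin N) (Fin N) ℂ) * (B : Matrix (Fin N) (Fin N) ℂ)) := by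
    rw [← h2]; exact exp_smul_conj_SU (A * B) t _
  have e3 : NormedSpace.exp (t • -((A : Matrix (Fin N) (Fin N) ℂ) * (B : Matrix (Fin N) (Fin N) ℂ) * (X₃ : Matrix (Fin N) (Fin N) ℂ) * star ((A : Matrix (Fin N) (Fin N) ℂ) * (B : Matrix (Fin N) (Fin N) ℂ))))
      = (A : Matrix (Fin N) (Fin N) ℂ) * (B : Matrix (Fin N) (Fin N) ℂ) * NormedSpace.exp (-(t • (X₃ : Matrix (Fin N) (Fin N) ℂ))) * star ((A : Matrix (Fin N) (Fin N) ℂ) * (B : Matrix (Fin N) (Fin N) ℂ)) := by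
    rw [← h2]; exact exp_smul_neg_conj_SU (A * B) t _
  have e4 : NormedSpace.exp (t • -((A : Matrix (Fin N) (Fin N) ℂ) * (B : Matrix (Fin N) (Fin N) ℂ) * star (C : Matrix (Fin N) (Fin N) ℂ) * (X₄ : Matrix (Fin N) (Fin N) ℂ) * star ((A : Matrix (Fin N) (Fin N) ℂ) * (B : Matrix (Fin N) (Fin N) ℂ) * star (C : Matrix (Fin N) (Fin N) ℂ))))
      = (A : Matrix (Fin N) (Fin N) ℂ) * (B : Matrix (Fin N) (Fin N) ℂ) * star (C : Matrix (Fin N) (Fin N) ℂ) * NormedSpace.exp (-(t • (X₄ : Matrix (Fin N) (Fin N) ℂ))) * star ((A : Matrix (Fin N) (Fin N) ℂ) * (B : Matrix (Fin N) (Fin N) ℂ) * star (C : Matrix (Fin N) (Fin N) ℂ)) := by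
    rw [← h3]; exact exp_smul_neg_conj_SU (A * B * C⁻¹) t _
  simp only [holPath_cons, holPath_nil]
  rw [e1, e2, e3, e4]
  simp only [mul_one, star_mul, star_star, star_exp_smul_lieSU, mul_assoc, star_coe_mul_coe_mul_SU, coe_mul_star_coe_mul_SU]

variable {P : Params} {j : ℕ} [NeZero N]

/-- ★ **THE FACTORISATION (3.1) ON THE LATTICE**: for a configuration `U`, a direction `X : bonds → 𝔰𝔲(N)` and a plaquette `p = ⟨x; μ < ν⟩`,
`(U·e^{tX})(∂p) = e^{tX′₁}e^{tX′₂}e^{tX′₃}e^{tX′₄}·U(∂p)` with the four transported letters of the module docstring (`𝕌₁ = U⟨x,μ⟩`, `𝕌₂ = U⟨x+e_μ,ν⟩`, `𝕌₃ = U⟨x+e_ν,μ⟩`,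
`𝕌₄ = U⟨x,ν⟩`). [cite: Balaban1985BackgroundPropagators, (3.1)–(3.2) p.390, (3.5) p.391] -/
theorem coe_plaqHol_expChart_smul (U : GaugeField P j (SU N)) (X : PBond P j → lieSU (Fin N)) (t : ℝ) (p : Plaq P j) :
    ((GaugeField.plaqHol (expChart U (t • X)) p : SU N) : Matrix (Fin N) (Fin N) ℂ)
      = holPath ℝ [ (U ⟨p.src, p.μ⟩ : Matrix (Fin N) (Fin N) ℂ) * (X ⟨p.src, p.μ⟩ : Matrix (Fin N) (Fin N) ℂ) * star (U ⟨p.src, p.μ⟩ : Matrix (Fin N) (Fin N) ℂ),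
            (U ⟨p.src, p.μ⟩ : Matrix (Fin N) (Fin N) ℂ) * (U ⟨p.src.shift p.μ, p.ν⟩ : Matrix (Fin N) (Fin N) ℂ) * (X ⟨p.src.shift p.μ, p.ν⟩ : Matrix (Fin N) (Fin N) ℂ)
              * star ((U ⟨p.src, p.μ⟩ : Matrix (Fin N) (Fin N) ℂ) * (U ⟨p.src.shift p.μ, p.ν⟩ : Matrix (Fin N) (Fin N) ℂ)),
            -((U ⟨p.src, p.μ⟩ : Matrix (Fin N) (Fin N) ℂ) * (U ⟨p.src.shift p.μ, p.ν⟩ : Matrix (Fin N) (Fin N) ℂ) * (X ⟨p.src.shift p.ν, p.μ⟩ : Matrix (Fin N) (Fin N) ℂ)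
              * star ((U ⟨p.src, p.μ⟩ : Matrix (Fin N) (Fin N) ℂ) * (U ⟨p.src.shift p.μ, p.ν⟩ : Matrix (Fin N) (Fin N) ℂ))),
            -((U ⟨p.src, p.μ⟩ : Matrix (Fin N) (Fin N) ℂ) * (U ⟨p.src.shift p.μ, p.ν⟩ : Matrix (Fin N) (Fin N) ℂ) * star (U ⟨p.src.shift p.ν, p.μ⟩ : Matrix (Fin N) (Fin N) ℂ) * (X ⟨p.src, p.ν⟩ : Matrix (Fin N) (Fin N) ℂ)
              * star ((U ⟨p.src, p.μ⟩ : Matrix (Fin N) (Fin N) ℂ) * (U ⟨p.src.shift p.μ, p.ν⟩ : Matrix (Fin N) (Fin N) ℂ) * star (U ⟨p.src.shift p.ν, p.μ⟩ : Matrix (Fin N) (Fin N) ℂ))) ] t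
        * ((GaugeField.plaqHol U p : SU N) : Matrix (Fin N) (Fin N) ℂ) := by
  rw [coe_plaqHol_eq, coe_plaqHol_eq, coe_expChart_smul, coe_expChart_smul, coe_expChart_smul, coe_expChart_smul]
  exact mul_mul_star_mul_star_expSU_eq_holPath_mul _ _ _ _ _ _ _ _ t

end Factorisation

/-! ## §3  The action along the ray, and its first two derivatives at every `t` -/

section Derivatives

variable {N : ℕ}

/-- `Re Tr` is a continuous `ℝ`-linear functional: it passes through `HasDerivAt`. [cite: Balaban1987RG1, (0.2) p.252 (bookkeeping)] -/
theorem hasDerivAt_re_trace {f : ℝ → Matrix (Fin N) (Fin N) ℂ} {f' : Matrix (Fin N) (Fin N) ℂ} {t : ℝ} (h : HasDerivAt f f' t) :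
    HasDerivAt (fun s : ℝ => (Matrix.trace (f s)).re) (Matrix.trace f').re t := by
  have hT := (LinearMap.toContinuousLinearMap (Matrix.traceLinearMap (Fin N) ℝ ℂ)).hasFDerivAt.comp_hasDerivAt t h
  have hR := Complex.reCLM.hasFDerivAt.comp_hasDerivAt t hT
  exact hR

/-- Along a transport path: `d∕ds Re Tr(Π_k e^{s a_k}·W) = Re Tr(D₁(s)·W)` (pub-balaban's `hasDerivAt_holPath`). [cite: Balaban1985BackgroundPropagators, (3.2) p.390] -/
theorem hasDerivAt_re_trace_holPath_mul (l : List (Matrix (Fin N) (Fin N) ℂ)) (W : Matrix (Fin N) (Fin N) ℂ) (t : ℝ) :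
    HasDerivAt (fun s : ℝ => (Matrix.trace (holPath ℝ l s * W)).re) (Matrix.trace (D₁ ℝ l t * W)).re t :=
  hasDerivAt_re_trace ((hasDerivAt_holPath ℝ l t).mul_const W)

/-- … and once more: `d∕ds Re Tr(D₁(s)·W) = Re Tr(D₂(s)·W)` (pub-balaban's `hasDerivAt_D₁`). [cite: Balaban1985BackgroundPropagators, (3.2) p.390] -/
theorem hasDerivAt_re_trace_D₁_mul (l : List (Matrix (Fin N) (Fin N) ℂ)) (W : Matrix (Fin N) (Fin N) ℂ) (t : ℝ) :
    HasDerivAt (fun s : ℝ => (Matrix.trace (D₁ ℝ l s * W)).re) (Matrix.trace (D₂ ℝ l t * W)).re t :=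
  hasDerivAt_re_trace ((hasDerivAt_D₁ ℝ l t).mul_const W)

variable {P : Params} {j : ℕ} [NeZero N]

/-- **THE WILSON ACTION ALONG THE RAY** as a sum of transport paths against the EXACT plaquette variables:
`A(U·e^{tX}) = Σ_p (1 − Re Tr(e^{tX′₁}e^{tX′₂}e^{tX′₃}e^{tX′₄}·U(∂p))∕N)` — (3.1) summed over the plaquettes.
[cite: Balaban1985BackgroundPropagators, (3.1) p.390; Balaban1987RG1, (0.2) p.252] -/
theorem wilsonAction4_expChart_smul_eq (U : GaugeField P j (SU N)) (X : PBond P j → lieSU (Fin N)) (t : ℝ) :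
    wilsonAction4 (expChart U (t • X)) = ∑ p : Plaq P j, (1 - (Matrix.trace
      (holPath ℝ [ (U ⟨p.src, p.μ⟩ : Matrix (Fin N) (Fin N) ℂ) * (X ⟨p.src, p.μ⟩ : Matrix (Fin N) (Fin N) ℂ) * star (U ⟨p.src, p.μ⟩ : Matrix (Fin N) (Fin N) ℂ),
            (U ⟨p.src, p.μ⟩ : Matrix (Fin N) (Fin N) ℂ) * (U ⟨p.src.shift p.μ, p.ν⟩ : Matrix (Fin N) (Fin N) ℂ) * (X ⟨p.src.shift p.μ, p.ν⟩ : Matrix (Fin N) (Fin N) ℂ)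
              * star ((U ⟨p.src, p.μ⟩ : Matrix (Fin N) (Fin N) ℂ) * (U ⟨p.src.shift p.μ, p.ν⟩ : Matrix (Fin N) (Fin N) ℂ)),
            -((U ⟨p.src, p.μ⟩ : Matrix (Fin N) (Fin N) ℂ) * (U ⟨p.src.shift p.μ, p.ν⟩ : Matrix (Fin N) (Fin N) ℂ) * (X ⟨p.src.shift p.ν, p.μ⟩ : Matrix (Fin N) (Fin N) ℂ)
              * star ((U ⟨p.src, p.μ⟩ : Matrix (Fin N) (Fin N) ℂ) * (U ⟨p.src.shift p.μ, p.ν⟩ : Matrix (Fin N) (Fin N) ℂ))),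
            -((U ⟨p.src, p.μ⟩ : Matrix (Fin N) (Fin N) ℂ) * (U ⟨p.src.shift p.μ, p.ν⟩ : Matrix (Fin N) (Fin N) ℂ) * star (U ⟨p.src.shift p.ν, p.μ⟩ : Matrix (Fin N) (Fin N) ℂ) * (X ⟨p.src, p.ν⟩ : Matrix (Fin N) (Fin N) ℂ)
              * star ((U ⟨p.src, p.μ⟩ : Matrix (Fin N) (Fin N) ℂ) * (U ⟨p.src.shift p.μ, p.ν⟩ : Matrix (Fin N) (Fin N) ℂ) * star (U ⟨p.src.shift p.ν, p.μ⟩ : Matrix (Fin N) (Fin N) ℂ))) ] t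
        * ((GaugeField.plaqHol U p : SU N) : Matrix (Fin N) (Fin N) ℂ))).re / (Fintype.card (Fin N) : ℝ)) := by
  unfold wilsonAction4 wilsonAction
  refine Finset.sum_congr rfl fun p _ => ?_
  rw [one_mul, reTr_eq_traceLinearMap, Matrix.traceLinearMap_apply, coe_plaqHol_expChart_smul]

/-- ★ **THE FIRST DERIVATIVE OF THE ACTION ALONG THE RAY, AT EVERY `t`**: `d∕dt A(U·e^{tX}) = −(1∕N) Σ_p Re Tr(D₁[X′](t)·U(∂p))`, `D₁` pub-balaban's first
derivative of the transport path (at `t = 0`: `D₁(0) = Σ_k X′_k`, `deriv_wilsonAction4_expChart_zero`). [cite: Balaban1985BackgroundPropagators, (3.2) p.390, (3.7) p.391] -/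
theorem hasDerivAt_wilsonAction4_expChart_smul (U : GaugeField P j (SU N)) (X : PBond P j → lieSU (Fin N)) (t : ℝ) :
    HasDerivAt (fun s : ℝ => wilsonAction4 (expChart U (s • X)))
      (-(∑ p : Plaq P j, (Matrix.trace
        (D₁ ℝ [ (U ⟨p.src, p.μ⟩ : Matrix (Fin N) (Fin N) ℂ) * (X ⟨p.src, p.μ⟩ : Matrix (Fin N) (Fin N) ℂ) * star (U ⟨p.src, p.μ⟩ : Matrix (Fin N) (Fin N) ℂ),
            (U ⟨p.src, p.μ⟩ : Matrix (Fin N) (Fin N) ℂ) * (U ⟨p.src.shift p.μ, p.ν⟩ : Matrix (Fin N) (Fin N) ℂ) * (X ⟨p.src.shift p.μ, p.ν⟩ : Matrix (Fin N) (Fin N) ℂ)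
              * star ((U ⟨p.src, p.μ⟩ : Matrix (Fin N) (Fin N) ℂ) * (U ⟨p.src.shift p.μ, p.ν⟩ : Matrix (Fin N) (Fin N) ℂ)),
            -((U ⟨p.src, p.μ⟩ : Matrix (Fin N) (Fin N) ℂ) * (U ⟨p.src.shift p.μ, p.ν⟩ : Matrix (Fin N) (Fin N) ℂ) * (X ⟨p.src.shift p.ν, p.μ⟩ : Matrix (Fin N) (Fin N) ℂ)
              * star ((U ⟨p.src, p.μ⟩ : Matrix (Fin N) (Fin N) ℂ) * (U ⟨p.src.shift p.μ, p.ν⟩ : Matrix (Fin N) (Fin N) ℂ))),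
            -((U ⟨p.src, p.μ⟩ : Matrix (Fin N) (Fin N) ℂ) * (U ⟨p.src.shift p.μ, p.ν⟩ : Matrix (Fin N) (Fin N) ℂ) * star (U ⟨p.src.shift p.ν, p.μ⟩ : Matrix (Fin N) (Fin N) ℂ) * (X ⟨p.src, p.ν⟩ : Matrix (Fin N) (Fin N) ℂ)
              * star ((U ⟨p.src, p.μ⟩ : Matrix (Fin N) (Fin N) ℂ) * (U ⟨p.src.shift p.μ, p.ν⟩ : Matrix (Fin N) (Fin N) ℂ) * star (U ⟨p.src.shift p.ν, p.μ⟩ : Matrix (Fin N) (Fin N) ℂ))) ] t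
          * ((GaugeField.plaqHol U p : SU N) : Matrix (Fin N) (Fin N) ℂ))).re) / (Fintype.card (Fin N) : ℝ)) t := by
  have hfun := funext fun s : ℝ => wilsonAction4_expChart_smul_eq U X s
  rw [hfun]
  refine (HasDerivAt.fun_sum fun p _ => (((hasDerivAt_re_trace_holPath_mul _ _ t).div_const
    (Fintype.card (Fin N) : ℝ)).const_sub 1)).congr_deriv ?_
  rw [Finset.sum_neg_distrib, neg_div, Finset.sum_div]

/-- ★ **THE SECOND DERIVATIVE ALONG THE RAY, AT EVERY `t`** (the action along the ray is `C²`): the first-derivative function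
`t ↦ −(1∕N) Σ_p Re Tr(D₁[X′](t)·U(∂p))` has derivative `−(1∕N) Σ_p Re Tr(D₂[X′](t)·U(∂p))`, `D₂` pub-balaban's second derivative of the transport path
(at `t = 0`: `D₂(0) = (Σ_k X′_k)² + Σ_{k<l}[X′_k, X′_l]`, `D₂_zero`). [cite: Balaban1985BackgroundPropagators, (3.2) p.390, (3.6)–(3.7) p.391] -/
theorem hasDerivAt_firstVariation_expChart_smul (U : GaugeField P j (SU N)) (X : PBond P j → lieSU (Fin N)) (t : ℝ) :
    HasDerivAt (fun s : ℝ => -(∑ p : Plaq P j, (Matrix.trace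
        (D₁ ℝ [ (U ⟨p.src, p.μ⟩ : Matrix (Fin N) (Fin N) ℂ) * (X ⟨p.src, p.μ⟩ : Matrix (Fin N) (Fin N) ℂ) * star (U ⟨p.src, p.μ⟩ : Matrix (Fin N) (Fin N) ℂ),
            (U ⟨p.src, p.μ⟩ : Matrix (Fin N) (Fin N) ℂ) * (U ⟨p.src.shift p.μ, p.ν⟩ : Matrix (Fin N) (Fin N) ℂ) * (X ⟨p.src.shift p.μ, p.ν⟩ : Matrix (Fin N) (Fin N) ℂ)
              * star ((U ⟨p.src, p.μ⟩ : Matrix (Fin N) (Fin N) ℂ) * (U ⟨p.src.shift p.μ, p.ν⟩ : Matrix (Fin N) (Fin N) ℂ)),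
            -((U ⟨p.src, p.μ⟩ : Matrix (Fin N) (Fin N) ℂ) * (U ⟨p.src.shift p.μ, p.ν⟩ : Matrix (Fin N) (Fin N) ℂ) * (X ⟨p.src.shift p.ν, p.μ⟩ : Matrix (Fin N) (Fin N) ℂ)
              * star ((U ⟨p.src, p.μ⟩ : Matrix (Fin N) (Fin N) ℂ) * (U ⟨p.src.shift p.μ, p.ν⟩ : Matrix (Fin N) (Fin N) ℂ))),
            -((U ⟨p.src, p.μ⟩ : Matrix (Fin N) (Fin N) ℂ) * (U ⟨p.src.shift p.μ, p.ν⟩ : Matrix (Fin N) (Fin N) ℂ) * star (U ⟨p.src.shift p.ν, p.μ⟩ : Matrix (Fin N) (Fin N) ℂ) * (X ⟨p.src, p.ν⟩ : Matrix (Fin N) (Fin N) ℂ)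
              * star ((U ⟨p.src, p.μ⟩ : Matrix (Fin N) (Fin N) ℂ) * (U ⟨p.src.shift p.μ, p.ν⟩ : Matrix (Fin N) (Fin N) ℂ) * star (U ⟨p.src.shift p.ν, p.μ⟩ : Matrix (Fin N) (Fin N) ℂ))) ] s
          * ((GaugeField.plaqHol U p : SU N) : Matrix (Fin N) (Fin N) ℂ))).re) / (Fintype.card (Fin N) : ℝ))
      (-(∑ p : Plaq P j, (Matrix.trace
        (D₂ ℝ [ (U ⟨p.src, p.μ⟩ : Matrix (Fin N) (Fin N) ℂ) * (X ⟨p.src, p.μ⟩ : Matrix (Fin N) (Fin N) ℂ) * star (U ⟨p.src, p.μ⟩ : Matrix (Fin N) (Fin N) ℂ),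
            (U ⟨p.src, p.μ⟩ : Matrix (Fin N) (Fin N) ℂ) * (U ⟨p.src.shift p.μ, p.ν⟩ : Matrix (Fin N) (Fin N) ℂ) * (X ⟨p.src.shift p.μ, p.ν⟩ : Matrix (Fin N) (Fin N) ℂ)
              * star ((U ⟨p.src, p.μ⟩ : Matrix (Fin N) (Fin N) ℂ) * (U ⟨p.src.shift p.μ, p.ν⟩ : Matrix (Fin N) (Fin N) ℂ)),
            -((U ⟨p.src, p.μ⟩ : Matrix (Fin N) (Fin N) ℂ) * (U ⟨p.src.shift p.μ, p.ν⟩ : Matrix (Fin N) (Fin N) ℂ) * (X ⟨p.src.shift p.ν, p.μ⟩ : Matrix (Fin N) (Fin N) ℂ)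
              * star ((U ⟨p.src, p.μ⟩ : Matrix (Fin N) (Fin N) ℂ) * (U ⟨p.src.shift p.μ, p.ν⟩ : Matrix (Fin N) (Fin N) ℂ))),
            -((U ⟨p.src, p.μ⟩ : Matrix (Fin N) (Fin N) ℂ) * (U ⟨p.src.shift p.μ, p.ν⟩ : Matrix (Fin N) (Fin N) ℂ) * star (U ⟨p.src.shift p.ν, p.μ⟩ : Matrix (Fin N) (Fin N) ℂ) * (X ⟨p.src, p.ν⟩ : Matrix (Fin N) (Fin N) ℂ)
              * star ((U ⟨p.src, p.μ⟩ : Matrix (Fin N) (Fin N) ℂ) * (U ⟨p.src.shift p.μ, p.ν⟩ : Matrix (Fin N) (Fin N) ℂ) * star (U ⟨p.src.shift p.ν, p.μ⟩ : Matrix (Fin N) (Fin N) ℂ))) ] t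
          * ((GaugeField.plaqHol U p : SU N) : Matrix (Fin N) (Fin N) ℂ))).re) / (Fintype.card (Fin N) : ℝ)) t :=
  ((HasDerivAt.fun_sum fun p _ => hasDerivAt_re_trace_D₁_mul _ ((GaugeField.plaqHol U p : SU N) : Matrix (Fin N) (Fin N) ℂ) t).neg).div_const _

/-- ★★★ **THE SECOND VARIATION OF THE WILSON ACTION (5) AT THE BACKGROUND `U` IN THE DIRECTION `X`** — the letters of (3.6)–(3.7) against the EXACT
plaquette variable: `d²∕dt² A(U·e^{tX})∣_{t=0} = −(1∕N)·Σ_p Re Tr( [(X′₁+X′₂+X′₃+X′₄)² + Σ_{k<l}[X′_k, X′_l]]·U(∂p) )` (`commSum` = pub-balaban's ordered commutator sum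
«Σ_{b₁≺b₂}[A′(b₁), A′(b₂)]»; `X′₁+⋯+X′₄ = η·(D^η_U X)(p)` by (3.4)).  With print's `a_k = iηA′(b_k)` this is the bracket `½Σ_p[tr((D A)(p))² Re U₀(∂p) +
tr Σ i[A′,A′] η⁻²Im U₀(∂p)]` of (3.7) before splitting `U₀(∂p) = Re + i·Im` — the quadratic form `⟨X, Δ(U)X⟩` of p. 392, `Δ₁ = Δ(ζ₀ ≡ 1)` of [B16] (1.12)∕(1.17).
[cite: Balaban1985BackgroundPropagators, (3.2) p.390, (3.6)–(3.7) p.391, p.392; Balaban1989LargeFieldII, (1.12) p.359, (1.17) p.360] -/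
theorem hasDerivAt_deriv_wilsonAction4_expChart (U : GaugeField P j (SU N)) (X : PBond P j → lieSU (Fin N)) :
    HasDerivAt (deriv fun s : ℝ => wilsonAction4 (expChart U (s • X)))
      (-(∑ p : Plaq P j, (Matrix.trace
        ((((U ⟨p.src, p.μ⟩ : Matrix (Fin N) (Fin N) ℂ) * (X ⟨p.src, p.μ⟩ : Matrix (Fin N) (Fin N) ℂ) * star (U ⟨p.src, p.μ⟩ : Matrix (Fin N) (Fin N) ℂ)
            + (U ⟨p.src, p.μ⟩ : Matrix (Fin N) (Fin N) ℂ) * (U ⟨p.src.shift p.μ, p.ν⟩ : Matrix (Fin N) (Fin N) ℂ) * (X ⟨p.src.shift p.μ, p.ν⟩ : Matrix (Fin N) (Fin N) ℂ)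
              * star ((U ⟨p.src, p.μ⟩ : Matrix (Fin N) (Fin N) ℂ) * (U ⟨p.src.shift p.μ, p.ν⟩ : Matrix (Fin N) (Fin N) ℂ))
            + -((U ⟨p.src, p.μ⟩ : Matrix (Fin N) (Fin N) ℂ) * (U ⟨p.src.shift p.μ, p.ν⟩ : Matrix (Fin N) (Fin N) ℂ) * (X ⟨p.src.shift p.ν, p.μ⟩ : Matrix (Fin N) (Fin N) ℂ)
              * star ((U ⟨p.src, p.μ⟩ : Matrix (Fin N) (Fin N) ℂ) * (U ⟨p.src.shift p.μ, p.ν⟩ : Matrix (Fin N) (Fin N) ℂ)))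
            + -((U ⟨p.src, p.μ⟩ : Matrix (Fin N) (Fin N) ℂ) * (U ⟨p.src.shift p.μ, p.ν⟩ : Matrix (Fin N) (Fin N) ℂ) * star (U ⟨p.src.shift p.ν, p.μ⟩ : Matrix (Fin N) (Fin N) ℂ) * (X ⟨p.src, p.ν⟩ : Matrix (Fin N) (Fin N) ℂ)
              * star ((U ⟨p.src, p.μ⟩ : Matrix (Fin N) (Fin N) ℂ) * (U ⟨p.src.shift p.μ, p.ν⟩ : Matrix (Fin N) (Fin N) ℂ) * star (U ⟨p.src.shift p.ν, p.μ⟩ : Matrix (Fin N) (Fin N) ℂ))))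
          * ((U ⟨p.src, p.μ⟩ : Matrix (Fin N) (Fin N) ℂ) * (X ⟨p.src, p.μ⟩ : Matrix (Fin N) (Fin N) ℂ) * star (U ⟨p.src, p.μ⟩ : Matrix (Fin N) (Fin N) ℂ)
            + (U ⟨p.src, p.μ⟩ : Matrix (Fin N) (Fin N) ℂ) * (U ⟨p.src.shift p.μ, p.ν⟩ : Matrix (Fin N) (Fin N) ℂ) * (X ⟨p.src.shift p.μ, p.ν⟩ : Matrix (Fin N) (Fin N) ℂ)
              * star ((U ⟨p.src, p.μ⟩ : Matrix (Fin N) (Fin N) ℂ) * (U ⟨p.src.shift p.μ, p.ν⟩ : Matrix (Fin N) (Fin N) ℂ))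
            + -((U ⟨p.src, p.μ⟩ : Matrix (Fin N) (Fin N) ℂ) * (U ⟨p.src.shift p.μ, p.ν⟩ : Matrix (Fin N) (Fin N) ℂ) * (X ⟨p.src.shift p.ν, p.μ⟩ : Matrix (Fin N) (Fin N) ℂ)
              * star ((U ⟨p.src, p.μ⟩ : Matrix (Fin N) (Fin N) ℂ) * (U ⟨p.src.shift p.μ, p.ν⟩ : Matrix (Fin N) (Fin N) ℂ)))
            + -((U ⟨p.src, p.μ⟩ : Matrix (Fin N) (Fin N) ℂ) * (U ⟨p.src.shift p.μ, p.ν⟩ : Matrix (Fin N) (Fin N) ℂ) * star (U ⟨p.src.shift p.ν, p.μ⟩ : Matrix (Fin N) (Fin N) ℂ) * (X ⟨p.src, p.ν⟩ : Matrix (Fin N) (Fin N) ℂ)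
              * star ((U ⟨p.src, p.μ⟩ : Matrix (Fin N) (Fin N) ℂ) * (U ⟨p.src.shift p.μ, p.ν⟩ : Matrix (Fin N) (Fin N) ℂ) * star (U ⟨p.src.shift p.ν, p.μ⟩ : Matrix (Fin N) (Fin N) ℂ))))
          + commSum [ (U ⟨p.src, p.μ⟩ : Matrix (Fin N) (Fin N) ℂ) * (X ⟨p.src, p.μ⟩ : Matrix (Fin N) (Fin N) ℂ) * star (U ⟨p.src, p.μ⟩ : Matrix (Fin N) (Fin N) ℂ),
            (U ⟨p.src, p.μ⟩ : Matrix (Fin N) (Fin N) ℂ) * (U ⟨p.src.shift p.μ, p.ν⟩ : Matrix (Fin N) (Fin N) ℂ) * (X ⟨p.src.shift p.μ, p.ν⟩ : Matrix (Fin N) (Fin N) ℂ)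
              * star ((U ⟨p.src, p.μ⟩ : Matrix (Fin N) (Fin N) ℂ) * (U ⟨p.src.shift p.μ, p.ν⟩ : Matrix (Fin N) (Fin N) ℂ)),
            -((U ⟨p.src, p.μ⟩ : Matrix (Fin N) (Fin N) ℂ) * (U ⟨p.src.shift p.μ, p.ν⟩ : Matrix (Fin N) (Fin N) ℂ) * (X ⟨p.src.shift p.ν, p.μ⟩ : Matrix (Fin N) (Fin N) ℂ)
              * star ((U ⟨p.src, p.μ⟩ : Matrix (Fin N) (Fin N) ℂ) * (U ⟨p.src.shift p.μ, p.ν⟩ : Matrix (Fin N) (Fin N) ℂ))),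
            -((U ⟨p.src, p.μ⟩ : Matrix (Fin N) (Fin N) ℂ) * (U ⟨p.src.shift p.μ, p.ν⟩ : Matrix (Fin N) (Fin N) ℂ) * star (U ⟨p.src.shift p.ν, p.μ⟩ : Matrix (Fin N) (Fin N) ℂ) * (X ⟨p.src, p.ν⟩ : Matrix (Fin N) (Fin N) ℂ)
              * star ((U ⟨p.src, p.μ⟩ : Matrix (Fin N) (Fin N) ℂ) * (U ⟨p.src.shift p.μ, p.ν⟩ : Matrix (Fin N) (Fin N) ℂ) * star (U ⟨p.src.shift p.ν, p.μ⟩ : Matrix (Fin N) (Fin N) ℂ))) ])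
          * ((GaugeField.plaqHol U p : SU N) : Matrix (Fin N) (Fin N) ℂ))).re) / (Fintype.card (Fin N) : ℝ)) 0 := by
  have hd : deriv (fun s : ℝ => wilsonAction4 (expChart U (s • X))) = _ :=
    funext fun s => (hasDerivAt_wilsonAction4_expChart_smul U X s).deriv
  rw [hd]
  refine (hasDerivAt_firstVariation_expChart_smul U X 0).congr_deriv ?_
  congr 1; congr 1
  refine Finset.sum_congr rfl fun p _ => ?_
  rw [D₂_zero]
  simp only [List.sum_cons, List.sum_nil, add_zero, add_assoc]

/-- ★ **THE FIRST VARIATION ALONG THE RAY AT `t = 0`** (consistency with n07-e g8 ∕ 35f): `d∕dt A(U·e^{tX})∣₀ = −(1∕N)·Σ_p Re Tr((X′₁+X′₂+X′₃+X′₄)·U(∂p))`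
— the linear term `⟨D^η_{U₀}A, η⁻²Im ∂U₀⟩` of (3.7) before splitting `U₀(∂p)`. [cite: Balaban1985BackgroundPropagators, (3.2) p.390, (3.7) p.391; Balaban1985Variational, (5) p.278] -/
theorem deriv_wilsonAction4_expChart_zero (U : GaugeField P j (SU N)) (X : PBond P j → lieSU (Fin N)) :
    deriv (fun s : ℝ => wilsonAction4 (expChart U (s • X))) 0
      = -(∑ p : Plaq P j, (Matrix.trace
        (((U ⟨p.src, p.μ⟩ : Matrix (Fin N) (Fin N) ℂ) * (X ⟨p.src, p.μ⟩ : Matrix (Fin N) (Fin N) ℂ) * star (U ⟨p.src, p.μ⟩ : Matrix (Fin N) (Fin N) ℂ)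
            + (U ⟨p.src, p.μ⟩ : Matrix (Fin N) (Fin N) ℂ) * (U ⟨p.src.shift p.μ, p.ν⟩ : Matrix (Fin N) (Fin N) ℂ) * (X ⟨p.src.shift p.μ, p.ν⟩ : Matrix (Fin N) (Fin N) ℂ)
              * star ((U ⟨p.src, p.μ⟩ : Matrix (Fin N) (Fin N) ℂ) * (U ⟨p.src.shift p.μ, p.ν⟩ : Matrix (Fin N) (Fin N) ℂ))
            + -((U ⟨p.src, p.μ⟩ : Matrix (Fin N) (Fin N) ℂ) * (U ⟨p.src.shift p.μ, p.ν⟩ : Matrix (Fin N) (Fin N) ℂ) * (X ⟨p.src.shift p.ν, p.μ⟩ : Matrix (Fin N) (Fin N) ℂ)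
              * star ((U ⟨p.src, p.μ⟩ : Matrix (Fin N) (Fin N) ℂ) * (U ⟨p.src.shift p.μ, p.ν⟩ : Matrix (Fin N) (Fin N) ℂ)))
            + -((U ⟨p.src, p.μ⟩ : Matrix (Fin N) (Fin N) ℂ) * (U ⟨p.src.shift p.μ, p.ν⟩ : Matrix (Fin N) (Fin N) ℂ) * star (U ⟨p.src.shift p.ν, p.μ⟩ : Matrix (Fin N) (Fin N) ℂ) * (X ⟨p.src, p.ν⟩ : Matrix (Fin N) (Fin N) ℂ)
              * star ((U ⟨p.src, p.μ⟩ : Matrix (Fin N) (Fin N) ℂ) * (U ⟨p.src.shift p.μ, p.ν⟩ : Matrix (Fin N) (Fin N) ℂ) * star (U ⟨p.src.shift p.ν, p.μ⟩ : Matrix (Fin N) (Fin N) ℂ))))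
          * ((GaugeField.plaqHol U p : SU N) : Matrix (Fin N) (Fin N) ℂ))).re) / (Fintype.card (Fin N) : ℝ) := by
  rw [(hasDerivAt_wilsonAction4_expChart_smul U X 0).deriv]
  congr 1; congr 1
  refine Finset.sum_congr rfl fun p _ => ?_
  rw [D₁_zero]
  simp only [List.sum_cons, List.sum_nil, add_zero, add_assoc]

end Derivatives

end Literature.MathematicalPhysics.QuantumFieldTheory.Balaban1983to89.Node00

end
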